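import Summits.ResolutionOfSingularities.ResolutionOfSingularities.Theorems.SpreadCutCells
import Literature.AlgebraicGeometry.Resolution.HironakaTauScheme
import Literature.AlgebraicGeometry.Resolution.BlowupSequences
import Literature.AlgebraicGeometry.Resolution.MarkedIdeals
import Literature.AlgebraicGeometry.Resolution.StalkSpecializesLocalization
import Mathlib.Algebra.CharP.Defs
import Mathlib.Algebra.CharP.Lemmas
import Mathlib.Data.Nat.Multiplicity
import Mathlib.AlgebraicGeometry.Morphisms.Smooth
import HarnessLib

/-!
# CrossCutLaw — decomp-res node «CrossCut» (lens-2 g20), file 1/3 of `CrossCutLaw`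

[WRITER NOTE (decomp-res writer g10).  Content VERBATIM from the decomp-res lens-2 g20 node
`HOME/decomp-res-lens-2/g20/CrossCut.lean` (pin 9ac8d1ca, 4 409 l; HOME = run/shared/lean/pub/decomp-res);
CRITIC-LEDGER row 160 (+1); landing orders INBOX :600 (and lens INBOX :582): l. 112–3564 are `SpreadCut` b2959d31
VERBATIM (landed as `SpreadCutLaw…` · `SpreadCutCells` ·
`MaxContactCutSpreadCut`) and are DELETED here with the landed modules imported instead (namespaces
`…Theorems.PinchCut` / `JetCut` / `PurityCut` / `SplitCut` / `CylinderCut` /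
`SpreadCut` opened; same short names, byte-identical bodies — never two copies); NEW = §X (l. 3566–4407).  Namespace
`…Theorems.CrossCut` (the lens's `Theses.CrossCut` is
gate-reserved), sub-namespaces `Cross` / `Leaf` as in the lens (inside the re-entered `namespace Leaf` of §X.3 the
landed `…Theorems.PurityCut.Leaf` is opened so the g16
schema's short names resolve exactly as in the lens); file split only (tree files ≤ 400 lines): sections, variables,
the `open MvPolynomial` lines and every declaration exactly as in
the lens; the node's global dupNamespace-linter line dropped.  Node files, in import order: `CrossCutLaw` (§X.0 ring
level; continued `…2`) · `CrossCutCells` (§X.2–§X.7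
cone-free: the aside / port home; continued `…2`) · the wiring `MaxContactCutCrossCut` (§X BY NAME on the host
route, in the Theses cone).  All `--supports
stmt-ResolutionOfSingularities-29273` (`MaxContactCut.RungOne`); nothing closes 29273 — decided halves carry their
engines / ports as hypotheses (`CrossExit` is a paper engine);
exactly ONE located-residual aside on the lens-2 column (`Cross.CrossSpecialRung`) SUPERSEDES g19's
`Spread.SpreadSpecialRung`, re-located EXACTLY modulo the cross decided half,
and `ComponentPackagePort` is the column's ONE port item.  The lens header is kept verbatim below.]

# CrossCut — LAW (X): THE CROSS, i.e. THE TANGLE DECIDED AS ONE COMPONENT (critic window g20, CRITIC-LEDGER row 155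
(c) — «(iv) a
Tangle/Sing/Iso ENGINE with a NAMED inhabitant (the INSEP-vv tangle or an Iso point) decided, or exactly re-located;
test cn27 (i)–(iv):
re-derivable paper proof, typed, EXACT re-location of `Spread.SpreadSpecialRung`, inhabitant decided concretely»).
The STRUCTURAL DICHOTOMY of
this generation: at a spread-special core (g19's residual: the secondary curve of the top curve is SINGULAR over the
core), EITHER the singularity
is a SECOND TOP CURVE crossing the first transversally inside a regular surface, the first δ-steep (spread letters,
slope `m/2`, `m = 2q+1`) and the
second δ-flat with a DEEP PINCH of inert depth exactly `m` (face `z² + ε₂u₂^m·v²`) — the CROSS, decided here for the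
whole component `T = C₁ ∪ C₂`
by ONE package of length `2q` — OR it is not (cross-special: the located residual, booked by letter).

## §0  CLAIMS AGAINST THE WINDOW (row 155 (c))
(i) PAPER PROOF re-derivable: §X.1 below — every step is a chart identity of §X.0 (`cross_towerOne`, `cross_wStep`,
`cross_vStep`,
`cross_towerTwo`, `flank_tower`), g19's §Γ.1 (a)(b)(c) verbatim for the first tower, or a named port-L ingredient
(blow-up charts, controlled
transform, semicontinuity of order, `gr` of a regular local ring, properness, Eisenstein).  (ii) TYPED: the letters
`CrossShape` / `FlankShape`
over the NEW doubly-weighted monomial ideal `crossWt` and the flank weight `flankWt`, the scheme-level classes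
`IsCrossAt` / `IsFlankAt` /
`IsUniformCross` over the tree's `curvePrime`, `stalkIdeal`, `idealOrder` and g19's `IsSpreadAt`, the engine
`CrossExit : Prop`, the decided
class `IsCrossPt`, the NEW COMPONENT PORT `ComponentPackagePort` (many-branch units; contains g12's
`CurvePackagePort` by letter), the leaf
schema over it (`Leaf.genRungAt_of_componentPort`), the cut `Cross.*` — 0 sorry.  (iii) EXACT RE-LOCATION:
`Cross.spreadSpecialRung_iff_crossSpecialRung :
CrossGenericRung → (Spread.SpreadSpecialRung ↔ Cross.CrossSpecialRung)`, with `Cross.closes : CrossGenericRung →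
CrossSpecialRung →
MaxContactCut.RungOne` BY NAME and `Cross.rungOne_iff` (EXACT at the rung); the whole chain g14 … g19 and the tree
asides 33865/33866 re-located
too (§X.7).  (iv) INHABITANT DECIDED CONCRETELY: the TANGLE of INSEP-vv = `(z + v(u₁+u₂))² + u₁⁵ + v²u₂⁵ + u₂⁷ /𝔽₂`
IS a cross point with `q = 2`:
in the frame `(z′, u₁, u₂, b) = (z + v(u₁+u₂), u₁, u₂, v + u₂)` the member is `z′² + u₁⁵ + b²u₂⁵` EXACTLY (kernel
`represent_INSEPvv`,
characteristic `2`), the letter holds (`crossShape_insepVV`), both branches sit in the order-`2` locus (`insepVV_mem_sq_steep`,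
`insepVV_mem_sq_flat`), `Top = C₁ ∪ C₂` on the nose, the other closed points of `C₁` / `C₂` carry the spread / flank
letters, and the package
`(C₁; Σ₁; C₂″; Σ′₁)` ends with `in₂ = Z² + UW`, `τ = 3` (§X.1 HAND-OVER; NODE-g20 §3 for the hand computation of all
four charts).  On the
residual side: INSEP-v³ (cuspidal secondary curve, g19's certificate `insepV3_coeff_mem_sq`), `R1-notail`, the
Sing/Iso points of (iv) — booked.

## §1  THE LAW.  Marking `n = 2`.  A UNIFORM CROSS (`IsUniformCross I 2 q η₁ η₂`) is a pair of distinct top curves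
`C₁ = closure {η₁}` (STEEP) and
`C₂ = closure {η₂}` (FLAT) that meet, whose union `T` is open in the order-`2` locus, with, at every closed point,
the letter of its position:
CROSS letter at `C₁ ∩ C₂` (frame `(z,u₁,u₂,v)`, `(z,u₁,u₂) = 𝔭(C₁)`, `(z,u₁,v) = 𝔭(C₂)`, `f = z² + ε₁u₁^m + ε₂v²u₂^m
+ g`, tail and members
doubly weighted: `crossWt`), g19's SPREAD letter `IsSpreadAt I 2 m η₁` on `C₁ ∖ C₂`, FLANK letter on `C₂ ∖ C₁`
(frame `(z,u₁,v,t)`,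
`f = z² + μv² + ε₁u₁^m + g`, `μ̄` a UNIFORMISER of `𝒪_{C₂,y′}`: the deep pinch degenerates transversally exactly
once along `C₂`, at the tangle).

## §2  THE ENGINE `CrossExit` and its PAPER PROOF: §X.1.  MECHANISM in one sentence: along the tangle branch the
spread tower of `C₁` (g19) leaves
the flank weight `W₂ = q·i + a + q·e` INVARIANT and converts the flat branch's deep pinch `z² + ε₂u₂^m v²` into the
SUB-FLAT pinch `Z² + (ε₂u)·v²`
of inert depth `1 < n`; the section tower of the strict transform of `C₂` then lowers the transversal exponent `m ↦
m − 2k` while keeping the pinch,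
and at `k = q` the member `Z² + u(ε₁w + ε₂V²)` has `in₂ = Z² + ε̄₁UW`: `τ = 3`.  Side charts exit by order (`ε₂u`
linear over the core; Eisenstein
fibres over `η₂`; `ε₁u₁` linear at the end of every flank fibre).

## §3  INHABITANTS ON BOTH SIDES (NODE-g20 §3): decided — the INSEP-vv tangle and every point of its two top curves
(cross points), besides all of
g19's decided classes; residual — INSEP-v³'s core (cusp), `R1-notail`, the Iso/Sing points of the bed, every
spread-special point at a marking `≠ 2`
(`isCrossSpecialPt_iff_of_ne_two`).

## §4  PIECES AND TAGS (BY NAME).  `Cross.CrossGenericRung` — WEAKER · DECIDED-MOD-PORT(M+)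
(`Cross.crossGenericRung_of_ports`: the tree engines
(V)(D)(U)(R)(N), (M)(C)(G)(S)(JCyl)(Γ) and the NEW (X) as hypotheses — each DECIDED on paper in its node —, X1 via
the tree aside 30081
`MaxContactCut.MaxOrderThreefoldResolution`, the COMPONENT port at every marking `≥ 2` (COSTUME(M+), §X.1 (port)),
`OrderOneContact`).
`Cross.CrossSpecialRung` — THE LOCATED RESIDUAL: WEAKER BY LETTER than `Spread.SpreadSpecialRung`
(`Cross.crossSpecialRung_of_spreadSpecialRung`,
hypothesis-free) · UNDECIDED · IDEA-NEEDED · cofinal (`Cross.crossSpecialRung_iff_rungOne`) ⇒ score 0.  `CrossExit`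
— DECIDED (paper) · port L.
`ComponentPackagePort` — COSTUME(M+).  `IsCrossPt` — ATTACKABLE/decided leaf; `IsCrossSpecialPt` — IDEA-NEEDED leaf.
 EQUIV layer: exactly one
(`Cross.rungOne_iff`), the split beneath it = decided half ∧ located residual.  WHY NOVEL: no earlier node or tree
engine decides a point through
which TWO top curves pass (every curve port of the lineage demands `IsTopIsolatedClosure`); the lever is the
observation that g19's spread tower
is an ISOMETRY for the flank weight, so the deep pinch of the second branch is consumed, not disturbed, by the first
tower — one intrinsic package
for the whole component, and a port whose units are connected components rather than isolated closures.

## §5  WHAT IS LEFT (located, booked — NODE-g20 §7): CUSPIDAL secondary curves with ONE branch (INSEP-v³: `w⁵ +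
v̄³`; the embedded resolution of
`Γ ⊂ Σ_q` transported along the threefold tower — window (a), not claimed), crosses at markings `n ≥ 3` (the
isolated end point `P_n`, `τ = 1`),
flat branches of inert depth `d ≠ m`, tangential or singular branches at the tangle, three or more branches, top
SURFACES through the core
(tree 30458), the regimes `m ≢ −1 (mod n)`, mixed faces, NON-PRINCIPAL `I_y` beyond the deep letters (window (b)),
Sing / Iso (iv).  The letter
«depth EXACTLY `m`» is SHARP for this package (cheapest falsifier of over-reach, by hand): for `z² + u₁^m + v²u₂^d`,
`d > m`, Stage A leaves the
pinch `Z² + ε₂u^{d−m+1}·v²` of depth `≥ 2 = n` — still deep — and the `V`-chart of the blow-up of `C₂^{(q)}` then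
carries `Z′² + ε₂u^{d−m+1} + …`
of order `2`, `τ = 1`, with top CURVES in the fibre over `x_q`: not decided, correctly outside the class (NEXT-g21.md (c′)).

## This file

§X.0 (NEW, g20): LAW (X) THE CROSS, ring level — the cross letters and chart kernels at the TANGLE point where the
δ-steep top curve meets the flank, `InsepVVKernel`; PROVED kernels, VERBATIM (continued `…2` where the 400-line cap cuts).

Part 1/3 carries: `flankWt`.

(Sources: Hironaka1964 Ch. III; CossartJannsenSaito2020 Ch. 2, Ch. 8–9; CossartPiltant2008 Prop. 4.2;
CossartPiltant2019 Rem. 3.2; BierstoneGrigorievMilmanWlodarczyk2011 §3.1; Moh1987; Hauser2010Kangaroo; Giraud1975;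
Narasimhan1983.)
-/

open CategoryTheory AlgebraicGeometry TopologicalSpace IsLocalRing
open Literature.AlgebraicGeometry.Resolution
open Summit.ResolutionOfSingularities.ResolutionOfSingularities.Theorems
open Summit.ResolutionOfSingularities.ResolutionOfSingularities.Theorems.WeakOrderReduction
open Summit.ResolutionOfSingularities.ResolutionOfSingularities.Theorems.DeltaFaceCutClasses
open Summit.ResolutionOfSingularities.ResolutionOfSingularities.Theorems.RelativeDeltaCut
open Summit.ResolutionOfSingularities.ResolutionOfSingularities.Theorems.CurveLeafExit
open Summit.ResolutionOfSingularities.ResolutionOfSingularities.Theorems.PinchCut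
open Summit.ResolutionOfSingularities.ResolutionOfSingularities.Theorems.JetCut
open Summit.ResolutionOfSingularities.ResolutionOfSingularities.Theorems.PurityCut
open Summit.ResolutionOfSingularities.ResolutionOfSingularities.Theorems.SplitCut
open Summit.ResolutionOfSingularities.ResolutionOfSingularities.Theorems.CylinderCut
open Summit.ResolutionOfSingularities.ResolutionOfSingularities.Theorems.SpreadCut
open MvPolynomial

namespace Summit.ResolutionOfSingularities.ResolutionOfSingularities.Theorems.CrossCut

section CrossRing

variable {R : Type} [CommRing R]

/-! ## §X  NEW (g20): LAW (X) THE CROSS — the TANGLE point where the δ-steep top curve `C₁` (spread letters, slope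
`m/2`, `m = 2q+1`)
meets the δ-flat top curve `C₂` (a DEEP PINCH: face `z² + ε₂u₂^m·v²`, inert depth `m > n`), decided AS A WHOLE
COMPONENT `T = C₁ ∪ C₂`
of the top locus by ONE package of length `2q` — the spread tower of `C₁` CONVERTS the deep pinch of `C₂` into a
sub-flat pinch (depth
`n − 1 = 1`), and the section tower of the strict transform of `C₂` then exits with `τ = 3` (paper proof: module
docstring §X.1).  Ring
level (§X.0: the flank weight, the two letters, chart identities, the INSEP-vv certificates), scheme level (§X.2:
the letters over the
tree's `curvePrime` / `stalkIdeal` / `qWeighted`, the uniform class, ENGINE (X) `CrossExit`, the decided class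
`IsCrossPt`), the NEW
COMPONENT PORT (§X.3: `IsTopComponent`, `IsComponentExitPt`, `ComponentPackagePort` — engine-free bookkeeping,
COSTUME(M+), with the
curve port as a by-letter consequence; the leaf schema over it), and the CROSS cut (§X.4: `Cross.*`, `Cross.closes`
BY NAME, EXACT
re-location of g19's `Spread.SpreadSpecialRung`).  All 0 sorry. -/

/-!
### §X.1  ENGINE (X) `CrossExit` — DECIDED (paper proof; every step a chart identity of §X.0 or a named port-L
ingredient; `n = 2`)
DATA.  `Y` regular, `I`, `q ≥ 1`, `m := 2q + 1`, curve points `η₁ ≠ η₂` with `C_i := {x | η_i ⤳ x}` (each = `η_i` and closed points),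
`T := C₁ ∪ C₂`, `C₁ ∩ C₂ ≠ ∅`, `ord_x I = 2` on `T`, `T` open in the order-`2` locus, and at every CLOSED point of `T` the letter of its position
(`IsUniformCross I 2 q η₁ η₂`).  All computations are in the local rings `R = 𝒪_{Y,y}` at closed `y ∈ T` (blow-ups
commute with the flat base
change `Spec 𝒪_{Y,y} → Y`, StacksProject Tag 0805); every member `h` of `I_y` is written as an `R`-combination of
the generating monomials of
the letter's weight ideal (`crossWt`, `flankWt`, g19's `qWeighted`), and the chart substitutions act on the
monomials while the coefficients
ride along (they only raise orders).  Points over `T` in the tower are: over the closed points `y` (cross), `y′`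
(flank), `y″` (spread), and
over `η₁`, `η₂`.
WEIGHTS at a cross point `y`, frame `(z, u₁, u₂, v)`: `W₁(zⁱu₁ᵃu₂ᵇvᵉ) = m·i + 2(a+b)` (g19's δ-weight of `C₁`), `W₂
= q·i + a + q·e` (the flank
weight of `C₂`).  Letter: `f = z² + ε₁u₁^m + ε₂v²u₂^m + g ∈ I_y`, tail monomials `W₁ ≥ 2m+1 ∧ W₂ ≥ 2q+1`, member
monomials `W₁ ≥ 2m ∧ W₂ ≥ 2q`.
Two consequences used throughout: (α) a member monomial lies in `(z,u₁,u₂)²` (`i ≥ 2`; `i = 1 ⇒ a+b ≥ q+1`; `i = 0 ⇒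
a+b ≥ m`) and in
`(z,u₁,v)²` (`i+e ≥ 2`; `i+e = 1 ⇒ a ≥ q`; `i+e = 0 ⇒ a ≥ 2q`): BOTH BRANCHES ARE PERMISSIBLE at `y`; (β) for a TAIL monomial
`i + e_q ≥ 2`, where `e_q := a + b + q(i − 2)` (`i = 0 ⇒ a+b ≥ m+1`; `i = 1 ⇒ a+b ≥ q+1`; `i ≥ 2` clear), and for a member monomial `e_q ≥ 0`.
STAGE A — THE SPREAD TOWER OF `C₁` (length `q`): `s_A := (C₁; Σ₁; …; Σ_{q−1})`, `Σ_j := Top(I_j, 2) ∩ π_j⁻¹(C₁)` = the `ℙ¹`-bundle SURFACE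
`{z̄ = 0} ⊂ E_j` over `C₁` — g19 §Γ.1 (a)(b)(c) VERBATIM: its statements (the `z`-charts are empty of order; `h_j ∈
(z_j, u)²` along `Σ_j` for
`j ≤ q−1`; off `Σ_j` order `0`, on `Σ_j` order exactly `2`) use only `W₁ ≥ 2m` for members and the corner `z²`,
which the cross letter supplies at
the cross points and the spread letter at the spread points; over `η₁` g19's properness/semicontinuity argument is
unchanged.  (The strict
transform `C₂^{(j)}` of the flat branch — untouched, still a top curve — meets `π⁻¹(C₁)` only in the point `x_j := C₂^{(j)} ∩ E_j ∈ Σ_j`, so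
`Top(I_j) ∩ π⁻¹(C₁) = Σ_j` still.)  In the `u₂`-branch at a cross point (`z = z_j u^j`, `u₁ = wu`, `u₂ = u`; a monomial becomes
`z_jⁱ wᵃ u^{e_j} vᵉ`, `e_j = a + b + j(i−2)`) THE FLANK WEIGHT IS INVARIANT: with `z_j ↦ q`, `w ↦ 1`, `v ↦ q`, `u ↦
0` every transformed
monomial has the `W₂` of its ancestor (only powers of the weight-`0` parameter `u` are created or removed).
STAGE `q` OVER A CROSS POINT `y`.  `u₂`-branch: `f_q = z_q² + u·(ε₁w^m + ε₂v²) + g_q` (kernel `cross_towerOne`; `m −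
2q = 1`).  By g19 (a)/(c)
the order-`2` points over `C₁` lie on `V(z_q, u)` with `F̃ := ε₁w^m + ε₂v² + u·H₀ ∈ 𝔪_x`; over `y` (`u, v ∈ 𝔪_x`) this forces `w ∈ 𝔪_x`:
THE ONLY TOP POINT OVER `y` AT STAGE `q` IS `x_q = V(z_q, w, u, v)` (the `u₁`-branch has `F̃′ = ε₁ + ε₂v²w′^m +
u₁H₀′`, a unit over `y`: no
top points; `z`-charts: none).  At `x_q`, `(Z := z_q, w, v, u)` is a regular system, `C₂^{(q)} = V(Z, w, v)` (parameter `u`), and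
            `f_q = Z² + u·(ε₂v² + ε₁w^m) + G`,   tail monomials `Zⁱwᵃvᵉu^{e_q}·r` with `W₂ = q·i + a + q·e ≥ 2q + 1`
and `i + e_q ≥ 2` (β),
member monomials with `W₂ ≥ 2q`, `e_q ≥ 0`: A PINCH ALONG `C₂^{(q)}` WHOSE COEFFICIENT `ε₂u` HAS `u`-ADIC DEPTH ONE
(`< n = 2`: sub-flat) — the
spread tower has EATEN the inert depth `m` of the flank face `z² + ε₂u₂^m·v²`.  (`τ(x_q) = 1`: `in₂ f_q = Z̄²`,
every other term has order
`≥ 3` — g19's regularity letter fails at `x_q`, which is why (Γ) alone does not decide the tangle.)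
STAGE B — THE FLANK TOWER (length `q`): `s_B := (C₂^{(q)}; Σ′₁; …; Σ′_{q−1})`, `Σ′_k := Top(I_{q+k}, 2) ∩ E′_k`, shown below to be the
SECTION `{Z_k = V_k = 0}` of the `ℙ²`-bundle `E′_k → Σ′_{k−1} ≅ C₂^{(q)}` (a regular curve; closed by
semicontinuity; INTRINSIC, so the local
models at `x_q`, at the flank points and at `η₂` glue).  PERMISSIBILITY (P): `C₂^{(q)}` is regular (at `x_q`: part
of a regular system;
elsewhere `≅ C₂`, regular by the flank letters) and `h_q ∈ (Z, w, v)²` for every member by (α) read with `W₂`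
(invariant); inductively, at
stage `q + k` in the `w`-branch (`Z = Z_k w^k`, `v = V_k w^k`; monomial `Z_kⁱ w^{a_k} V_kᵉ u^{e_q}`, `a_k = a + k(i
+ e − 2)`) the SHIFTED
flank weight `W₂^{(k)} := (q−k)i + a_k + (q−k)e = W₂ − 2k` is `≥ 2(q−k)` on members and `≥ 2(q−k) + 1` on the tail, so for `k ≤ q − 1`
(`q − k ≥ 1`) every member monomial has `i + a_k + e ≥ 2`: `h^{(k)} ∈ (Z_k, w, V_k)² ⊇` the ideal of `Σ′_k` —
PERMISSIBLE; and the member is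
`f^{(k)} = Z_k² + u·(ε₁w^{m−2k} + ε₂V_k²) + G_k` (kernels `cross_wStep`, cumulatively `cross_towerTwo`).
LOCATION AND EXIT OVER `x_q` (`u ∈ 𝔪_x`).  Step `k → k+1`, three charts.  `Z`-chart (`w = w′Z_k`, `V = v′Z_k`): `f ↦
1 + ε₂u·v′² + Z_k·(…)`
(a tail monomial with `i + a_k + e = 2` would need `W₂^{(k)} ≤ 2(q−k)`, excluded; so every tail term keeps a factor
`Z_k`): a UNIT where `u = 0`
— no point of positive order over `x_q`.  `V`-chart (`Z_k = Z′V`, `w = w′V`; kernel `cross_vStep`): `f ↦ Z′² + ε₂u +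
u·ε₁w′^{…}V^{…} + G′`
with every tail term divisible by `V` and of order `≥ 2` at the points of `E′_{k+1}` (for `i = 0` the factor
`u^{e_q}`, `e_q ≥ 2`; for `i ≥ 1`
the factors `Z′ⁱ·V^{≥1}`): where `Z′(x) ≠ 0` the value is `Z′(x)² ≠ 0`; where `Z′(x) = 0` the term `ε₂u` is LINEAR
and nothing cancels it —
ORDER `≤ 1` at every point of the `V`-chart over `x_q`.  `w`-chart: on `E′_{k+1} = {w = 0}` over `x_q` the value of
`f^{(k+1)}` is `Z_{k+1}(x)²`
(tail terms keep a factor `w` or `u`), so top points have `Z_{k+1} ∈ 𝔪_x`; if `V_{k+1}(x) ≠ 0` the term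
`u·ε₂V_{k+1}²` is `u`·unit, LINEAR,
and no tail term is linear (`i = 0 ⇒ u^{≥2}`; `i ≥ 1 ⇒ Z·(Z,w,V,u)`): order `1`.  Hence `Top(I_{q+k+1}) ∩ π⁻¹(x_q) = {x_{q+k+1} := V(Z_{k+1}, w,
V_{k+1}, u)}` for `k + 1 ≤ q − 1` (order `2` there since `m − 2(k+1) ≥ 3`), and AT THE LAST STAGE `2q` (`k + 1 = q`,
`m − 2q = 1`):
            `f^{(q)} = Z_q² + u·(ε₁w + ε₂V_q²) + G_q`,   `G_q` = tail, every monomial with `a_q = W₂ − 2q ≥ 1` AND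
`i + e_q ≥ 2`, so of ORDER `≥ 3`
at `x_{2q}` (the `w`-linear tail terms `w·u^{e_q}·r`, `e_q ≥ 2`, included; over `η₂` they are absorbed: `ε₁u + Σ r
u^{e_q} = u·unit`).  Therefore
            `in₂ f^{(q)}(x_{2q}) = Z² + ε̄₁·U·W`,  an irreducible quadric in the three independent linear forms `Z,
U, W`:  **`τ(x_{2q}) = 3 ≥ 2`** —
the exit clause at the single top point over `y`; every other point over `x_q` has order `≤ 1` (shown), and
non-closed points over `y` of
order `2` would specialise (the tower is proper over `Y`) to closed top points over `y` other than `x_{2q}` in the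
same chart — there are none.
OVER `η₂` (`u` a UNIT, `ū ∈ k(η₂) = Frac 𝒪_{C₂}` of valuation `1` at `y`, so `−ε̄₂ū` and `−1/(ε̄₂ū)` are NOT squares
in `k(η₂)`): in the generic
fibre `ℙ²_{k(η₂)}` of `E′_{k+1}` the member restricts to `Z′² + ε̄₂ū` (`V`-chart), `1 + ε̄₂ū·v′²` (`Z`-chart),
`Z_{k+1}² + ε̄₂ū·V_{k+1}²` (`w`-chart;
the tail restricts to `0` on `E′` because every tail monomial acquires a factor `w`): IRREDUCIBLE polynomials, i.e.
regular parameters `P` at the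
(non-rational) points they define, and `f = P + (exceptional)·(…)` has ORDER `1` there (EISENSTEIN FIBRES); the one
exception is the point
`Z_{k+1} = V_{k+1} = 0` of the `w`-chart — the generic point of `Σ′_{k+1}` — of order `2` for `k+1 ≤ q−1` and of
order `1` at the last stage
(the `w`-linear term `u·unit·w`).  No top point over `η₂` survives stage `2q`.
OVER A FLANK POINT `y′ ∈ C₂ ∖ C₁` (closed).  Stage A is an isomorphism near `π⁻¹(y′)` (its centres lie over `C₁ ∌
y′`).  Frame `(z, u₁, v, t)`,
`𝔭₂ = (z, u₁, v)`, `f = z² + μv² + ε₁u₁^m + g`, `μ ∈ 𝔪 ∖ (𝔪² + 𝔭₂)`, i.e. `μ = δ·t + π` with `δ` a UNIT and `π ∈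
𝔭₂`; tail `W₂ ≥ 2q + 2`, members
`W₂ ≥ 2q` (`t ↦ 0`).  Permissibility of `C₂` and of the sections `Σ′_k = V(Z_k, u₁, V_k)` (`u₁`-branch: `z = Z_k
u₁^k`, `v = V_k u₁^k`,
`π ∈ 𝔭₂ ⊆ (u₁)` after one step, so `μ = δt + u₁π_k`; kernel `flank_tower`): as in (P) from `W₂^{(k)} ≥ 2(q−k)`, `k ≤
q−1`.  The member is
            `f^{(k)} = Z_k² + (δt + u₁π_k)·V_k² + ε₁u₁^{m−2k} + g_k`,   tail monomials with `i + a_k + e ≥ 3` at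
every stage `k ≤ q` (from
`W₂^{(k−1)} ≥ 2(q−k+1) + 2`), hence each divisible by `u₁` after the step and never `t`-linear.  `u₁`-chart over
`y′` (`t, u₁ ∈ 𝔪_x`): the value on
`E′_k` is `Z_k(x)²`; at a point with `Z_k ∈ 𝔪_x` and `V_k(x) = γ ≠ 0` the initial LINEAR form has `T`-coefficient
`δ̄γ² ≠ 0` (only `δtV_k²` is
`t`-linear): order `1`; at `γ = 0` the point `x′_k = Σ′_k ∩ π⁻¹(y′)` has order `2` for `k ≤ q−1` (`m − 2k ≥ 3`, tail
`u₁`-exponent `≥ 2`) and AT THE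
LAST STAGE `k = q` the term `ε₁u₁^{m−2q} = ε₁u₁` is LINEAR with `U₁`-coefficient `ε̄₁ + π̄_q·γ²` and `T`-coefficient
`δ̄γ²` — not both zero:
ORDER `1` AT EVERY POINT OVER `y′` (exit by order drop; no `τ` needed).  `v`-chart: `f ↦ Z′² + δt + v·(…)`: value
`Z′(x)²`, then `δt` linear:
order `≤ 1`.  `z`-chart: `1 + μv′² + z(…)`, a unit over `y′`.  (Over `η₂` near `y′`: the Eisenstein fibres again,
`μ̄` of valuation `1` at `y′`.)
OVER A SPREAD POINT `y″ ∈ C₁ ∖ C₂` and over `η₁`: g19's ENGINE (Γ) verbatim — after Stage A every order-`2` point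
over `y″` / `η₁` has `τ ≥ 3`;
Stage B is an isomorphism there (its centres lie over `C₂ ∌ y″`), so `τ ≥ 3` persists to stage `2q`.
THE PACKAGE `s := (C₁; Σ₁; …; Σ_{q−1}; C₂^{(q)}; Σ′₁; …; Σ′_{q−1})` (length `2q`) is weakly admissible for `(I, ∅, 2)` (permissibility (b)/(P)),
all centres lie over `T` (`CentresOver`), `s.top` is regular (regular centres in regular schemes), and every point
of `s.top` over `T` of order
`2` has `τ ≥ 2` (indeed `= 3` at the `x_{2q}` over the cross points, `≥ 3` over the spread points and `η₁`, and
there are none over the flank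
points and `η₂`): `PackageExitsOver I 2 T`.  ∎
THE HAND-OVER AT THE TANGLE (what the window asks to see, INSEP-vv, `q = 2`, NODE-g20 §3): `f = z′² + u₁⁵ + b²u₂⁵`;
`C₁`: `f₁ = z₁² + u³(w⁵ + b²)`,
`Σ₁`: `f₂ = z₂² + u(w⁵ + b²)` — at `x₂ = (z₂, w, b, u)` `τ = 1`, the spread letter's secondary form `w⁵ + b̄²` has
the DOUBLE ROOT `w = b̄ = 0` over
the core: exactly the failure of g19's `RelSimple`; `C₂^{(2)} = V(z₂, w, b)`: `f₃ = Z₁² + u(w³ + B₁²)`; `Σ′₁ = V(Z₁,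
w, B₁)`: `f₄ = Z₂² + u(w + B₂²)`,
`in₂ = Z² + UW`, **`τ = 3`**.  Four blow-ups, all centres intrinsic (`C₁`; `Top ∩ E₁`; the strict transform of `C₂`;
`Top ∩ E′₁`).
SCOPE (honest).  `n = 2` only: for `n ≥ 3` the same two towers applied to `zⁿ + ε₁u₁^m + ε₂vⁿu₂^m` (`m = (q+1)n − 1`) end at
`P_n = Zⁿ + u^{n−1}(ε₂Vⁿ + ε₁W^{n−1})` with `inₙ = Z̄ⁿ`, `τ = 1` — an ISOLATED top point not decided by this engine
(booked, NODE-g20 §7).  The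
flat branch must carry inert depth EXACTLY `m` in `v²` (the INSEP-vv shape); other depths, tangential branches
(`C₁`, `C₂` not transversal
inside a regular surface), three branches, and top SURFACES through the core are outside the letter (the residual, §X.4).

### §X.1 (port)  `ComponentPackagePort` — COSTUME(M+), engine-free (proof = the tree's g12 port proof with one more
kind of unit)
In the frame of `SeqDimFour` the top locus `Top = {ord = n}` is closed (semicontinuity) and noetherian.  The
hypothesis sorts every top point into:
class ≥ 2 (no centre needed before `SeqDimFour 2 n` applies), or a point carrying a UNIT WITH A PACKAGE — an
isolated closed exit point (g10/g11:
`{y}` open in `Top`), a Top-isolated curve `closure {η}` (g12), or a top component `T` (`IsTopComponent`: `T ⊆ Top`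
preconnected with an open
`U ⊇ T`, `U ∩ Top ⊆ T`, and `T` CLOSED: `T` is OPEN AND CLOSED in `Top`).  Units of all four kinds are non-empty,
connected, open-and-closed
subsets of `Top`, hence each is a connected component of `Top`, two of them are DISJOINT OR EQUAL, and there are
finitely many (noetherian).  Process them one at a
time: run the unit's package `s` (weakly admissible, centres over the unit, so `s` is an isomorphism off the
preimage of the unit and the other
units are transported unchanged together with their packages — blow-ups commute with open immersions); afterwards
every point over the unit
has order `< n` or `τ ≥ 2` (class ≥ 2).  After the last unit every top point of the transformed datum is of class ≥
2, `SeqDimFour 2 n` yields a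
weak resolution of it, and the concatenation is a weak resolution of `(I, ∅, n)` (tree: `WeakResolution` of a
concatenation).  Port-L
ingredients only (the tree's `CentreSeq` calculus, semicontinuity of order, noetherian induction on components) — NO
new mathematics; the
statement is kept as a hypothesis of the kernels exactly like the tree's `CurvePackagePort`, which it implies by letter
(`curvePackagePort_of_componentPackagePort`).
-/

/-! ### §X.0  ring level -/

/-- **THE FLANK WEIGHT** [g20] (`flankWt z u v q λ`): the ideal generated by the monomials `zⁱ uʲ vᵏ` with `q·i + j
+ q·k ≥ λ` — the
monomial valuation ideals of weight `(z ↦ q, u₁ ↦ 1, v ↦ q)` on the parameters `(z, u₁, v)` TRANSVERSAL TO THE FLAT BRANCH `C₂`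
(every other parameter has weight `0`).  `J ⊆ flankWt z u₁ v q (2q)` says: every member of `J` stays of order `≥ 2`
along the strict
transform of `C₂` after the `q` steps of the spread tower of `C₁` AND along each of the `q − 1` sections of the
flank tower (§X.1 (P));
`g ∈ flankWt … (2q+1)` says the tail is strictly above the flank face `z² + ε₂u₂^m v²`.  The weight is INVARIANT
under the spread
tower (its substitutions only introduce powers of the weight-`0` parameter `u₂`).  DEFINITION (NEW object).
(Sources: Hironaka1967;
CossartJannsenSaito2020 Ch. 8; CossartPiltant2008 Prop. 4.2.) -/
def flankWt (z u v : R) (q l : ℕ) : Ideal R :=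
  Ideal.span {x | ∃ i j k : ℕ, l ≤ q * i + j + q * k ∧ x = z ^ i * u ^ j * v ^ k}

end CrossRing

end Summit.ResolutionOfSingularities.ResolutionOfSingularities.Theorems.CrossCut
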